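import Mathlib
import Literature.NumberTheory.LFunctions.Zhang2022.Section11WindowSj
import Literature.NumberTheory.LFunctions.Zhang2022.Section4Lemma44Chain
import HarnessLib

/-!
# Zhang (2022) §12 p. 67 / §7 Prop. 7.1: the `n`-window of the majorant of `ξ₀ⱼ` for a GENERAL window
# ratio `θ`, with the `X`-dependence kept

Topic `Literature/NumberTheory/LFunctions/Zhang2022` (Landau–Siegel audit tree; verdict-neutral).
Y. Zhang, *Discrete mean estimates and the Landau–Siegel zero*, arXiv:2211.02515v1 (2022)
[Zhang2022LandauSiegel] — **an unrefereed manuscript under adjudication; nothing here asserts or denies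
its Theorems 1–2.** ZHANG-L discharge lane, WP12 (binder `h128 : Typed.Sec12A.Eq128 c′`, GAP row
G-d42-3 (ii): the `S_j`-smallness for the dual-side window sequence of (12.8)); companion of
`Section12ThinWindowSums`.

The tree's `WindowSj.window_gC_div_le` gives `Σ_{X<n<θX} gC(n)/n ≤ C𝓛⁸` for the FIXED ratio
`θ = e^{2𝓛⁻¹⁰}` uniformly in `X ≤ P`. The thin-window engine for `h128` needs (i) a general ratio
`1 < θ ≤ 2` with `2𝓛⁻¹⁰ ≤ θ − 1` (its windows are `(xη₋², xη₊)`, ratio `e^{3𝓛⁻¹⁰}`, so that the closed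
window edges of the typed sequences are covered), and (ii) the `X`-dependence `(θ−1)(1 + log X)²` for
`X ≥ 𝓛¹⁴` and `(1 + 14 log 𝓛)³`-type bounds for `X < 𝓛¹⁴` (no power of `𝓛` may be lost there). Same proof
as the tree's (Shiu's theorem for `gC`, `XiZeroMajorant.gC_window_div_le`, log-mean exponent `3` from
`WindowSj.gC_prime_le_aKM`; Euler-product majorant `sum_div_le_gen` below `𝓛¹⁴`). Results:

* `window_gC_div_le_shiu` — `Σ_{n∈S} gC(n)/n ≤ C·(θ − 1)·(log X)²` for `S ⊆ (X, θX)`, `𝓛¹⁴ ≤ X ≤ P`;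
* `sum_gC_div_le_small` — `Σ_{n ≤ 4𝓛¹⁴} gC(n)/n ≤ C·(1 + log 𝓛)³`;
* `window_gC_div_le_gen` — the uniform `Σ_{n∈S} gC(n)/n ≤ C·𝓛⁸` for `S ⊆ (X, θX)`, `0 < X ≤ P`.

No definitions; no statement about Landau–Siegel zeros is made or implied.

## References

* Y. Zhang, arXiv:2211.02515v1 (2022), §7 Prop. 7.1 p. 33; §12 pp. 66–68.
  [cite: Zhang2022LandauSiegel, §7 Prop. 7.1 p.33; §12 (12.6)–(12.8) p.67]
* P. Shiu, J. reine angew. Math. 313 (1980), 161–170, Theorem 1. [cite: Shiu1980, Theorem 1]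
* R. R. Hall, G. Tenenbaum, *Divisors* (CUP 1988), (0.4). [cite: HallTenenbaum1988, (0.4)]
-/

noncomputable section

open Finset Real ArithmeticFunction

namespace Literature.NumberTheory.LFunctions.Zhang2022.ThinWindow

open XiZeroMajorant MeanSquareMajorant Skeleton WindowSj

/-- **The `n`-window of `gC`, Shiu regime, general ratio.** There is an absolute `C ≥ 0` such that for
every `c′` and `D ≥ D₀(c′)`: for `1 < θ ≤ 2` with `2𝓛⁻¹⁰ ≤ θ − 1`, `𝓛¹⁴ ≤ X ≤ P`, and any finite set `S`
of integers `n ≥ 1` with `X < n < θX`,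
`Σ_{n∈S} gC c′ D (n)/n ≤ C·(θ − 1)·(log X)²`
(Shiu for `gC` with exponent `3`: `(θ−1)(log X)³/log X`). [cite: Shiu1980, Theorem 1] -/
theorem window_gC_div_le_shiu : ∃ C : ℝ, 0 ≤ C ∧ ∀ c' : ℝ, ∃ D₀ : ℕ, ∀ D : ℕ, D₀ ≤ D →
    ∀ X θ : ℝ, 1 < θ → θ ≤ 2 → 2 * (ell D ^ 10)⁻¹ ≤ θ - 1 → ell D ^ 14 ≤ X → X ≤ bigP D →
    ∀ S : Finset ℕ, (∀ n ∈ S, 1 ≤ n ∧ X < n ∧ (n : ℝ) < θ * X) →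
      ∑ n ∈ S, gC c' D n / n ≤ C * (θ - 1) * Real.log X ^ 2 := by
  obtain ⟨C₀, x₀, hC₀, hx₀2, hW⟩ := gC_window_div_le
  have hT3 := LogEulerProduct.tailConst_nonneg 3
  have hM0 := M0_nonneg
  set E₀ : ℝ := Real.exp (48 + 7 * M0 + 126 * π) with hE₀
  refine ⟨C₀ * E₀, by positivity, fun c' => ?_⟩
  refine ⟨max ⌈Real.exp (5 * |c'| * π + 3)⌉₊ ⌈Real.exp x₀⌉₊,
    fun D hD X θ hθ1 hθ2 hθlo hX14 hXP S hS => ?_⟩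
  obtain ⟨hL3, hB⟩ := three_le_ell_and_Bsum_le (le_trans (le_max_left _ _) hD)
  have hLx₀ : x₀ ≤ ell D := Section4.le_ell_of_ceil_exp_le (le_trans (le_max_right _ _) hD)
  set ℓ : ℝ := ell D with hℓ
  have hℓ1 : 1 ≤ ℓ := by linarith
  have hℓ0 : 0 < ℓ := by linarith
  have hB0 : 0 ≤ Bsum c' D := Bsum_nonneg c' D
  have hK : 0 ≤ 7 * Bsum c' D := by positivity
  have hM : (0 : ℝ) ≤ 36 + 7 * M0 := by positivity
  have hlogP : Real.log (bigP D) = ℓ ^ 9 := by rw [bigP, Real.log_exp]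
  have hgp : ∀ p : ℕ, p.Prime → (p : ℝ) ≤ X →
      gC c' D p ≤ ((3 : ℕ) : ℝ) + 7 * Bsum c' D * Real.log p + (36 + 7 * M0) / p :=
    fun p hp _ => gC_prime_le_aKM c' D hp
  have hXℓ : ℓ ≤ X := le_trans (le_self_pow₀ hℓ1 (by norm_num)) hX14
  have hXx₀ : x₀ ≤ X := hLx₀.trans hXℓ
  have hX2 : 2 ≤ X := hx₀2.trans hXx₀
  have hX0 : 0 < X := by linarith
  have hlogX0 : 0 < Real.log X := Real.log_pos (by linarith)
  -- `X^{1/4} ≤ (θ - 1)X`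
  have hy : X ^ (1 / 4 : ℝ) ≤ (θ - 1) * X := by
    have h34 : X ^ (-(3 / 4) : ℝ) ≤ 2 * (ell D ^ 10)⁻¹ := by
      have h1 : X ^ (-(3 / 4) : ℝ) ≤ (ℓ ^ 14) ^ (-(3 / 4) : ℝ) :=
        Real.rpow_le_rpow_of_nonpos (by positivity) hX14 (by norm_num)
      have h2 : (ℓ ^ 14) ^ (-(3 / 4) : ℝ) = ℓ ^ (-(21 / 2) : ℝ) := by
        rw [← Real.rpow_natCast ℓ 14, ← Real.rpow_mul hℓ0.le]; norm_num
      have h3 : ℓ ^ (-(21 / 2) : ℝ) ≤ ℓ ^ (-(10 : ℝ)) :=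
        Real.rpow_le_rpow_of_exponent_le hℓ1 (by norm_num)
      have h4 : ℓ ^ (-(10 : ℝ)) = (ell D ^ 10)⁻¹ := by
        rw [Real.rpow_neg hℓ0.le, hℓ]; norm_num
      calc X ^ (-(3 / 4) : ℝ) ≤ (ell D ^ 10)⁻¹ := by rw [← h4]; exact h1.trans (h2 ▸ h3)
        _ ≤ 2 * (ell D ^ 10)⁻¹ := by linarith [inv_nonneg.mpr (pow_nonneg hℓ0.le 10)]
    have hsplit : X ^ (1 / 4 : ℝ) = X * X ^ (-(3 / 4) : ℝ) := by
      rw [show (1 / 4 : ℝ) = 1 + -(3 / 4) by norm_num, Real.rpow_add hX0, Real.rpow_one]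
    rw [hsplit, mul_comm]
    exact mul_le_mul_of_nonneg_right (h34.trans hθlo) hX0.le
  have hwin := hW c' D 3 (7 * Bsum c' D) (36 + 7 * M0) hK hM X θ hXx₀ hθ1 hθ2 hy hgp
  have hsub : S ⊆ (Icc 1 ⌊θ * X⌋₊).filter (fun n : ℕ => X < n) := by
    intro n hn
    obtain ⟨h1, h2, h3⟩ := hS n hn
    rw [mem_filter, mem_Icc]
    exact ⟨⟨h1, Nat.le_floor h3.le⟩, h2⟩
  have hKlog : 7 * Bsum c' D * Real.log (4 * X) ≤ 126 * π := by
    have hlog4X : Real.log (4 * X) ≤ 2 * ℓ ^ 9 := by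
      rw [Real.log_mul (by norm_num) hX0.ne']
      have hl9 : (2 : ℝ) ≤ ℓ ^ 9 := by
        calc (2 : ℝ) ≤ 2 ^ 9 := by norm_num
          _ ≤ ℓ ^ 9 := pow_le_pow_left₀ (by norm_num) (by linarith) 9
      have : Real.log 4 ≤ 2 := by
        have h2 : Real.log 4 = 2 * Real.log 2 := by
          rw [show (4:ℝ) = 2 ^ 2 by norm_num, Real.log_pow]; ring
        have h3 := Real.log_le_sub_one_of_pos (show (0:ℝ) < 2 by norm_num)
        linarith
      have hlogXP : Real.log X ≤ ℓ ^ 9 := by rw [← hlogP]; exact Real.log_le_log hX0 hXP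
      linarith
    have hlog0 : 0 ≤ Real.log (4 * X) := Real.log_nonneg (by linarith)
    calc 7 * Bsum c' D * Real.log (4 * X) ≤ 7 * (9 * π / ℓ ^ 9) * (2 * ℓ ^ 9) := by gcongr
      _ = 126 * π := by field_simp; ring
  have hexp : Real.exp (4 * (3 : ℕ) + 7 * Bsum c' D * Real.log (4 * X) + (36 + 7 * M0)) ≤ E₀ := by
    rw [hE₀]; refine Real.exp_le_exp.mpr ?_; push_cast; linarith
  have hlog2 : Real.log X ^ (3 : ℕ) / Real.log X = Real.log X ^ 2 := by field_simp
  have hθ0 : 0 ≤ θ - 1 := by linarith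
  calc ∑ n ∈ S, gC c' D n / n
      ≤ ∑ n ∈ (Icc 1 ⌊θ * X⌋₊).filter (fun n : ℕ => X < n), gC c' D n / n :=
        sum_le_sum_of_subset_of_nonneg hsub fun n _ _ =>
          div_nonneg (gC_nonneg c' D n) (Nat.cast_nonneg n)
    _ ≤ C₀ * Real.exp (4 * (3 : ℕ) + 7 * Bsum c' D * Real.log (4 * X) + (36 + 7 * M0)) *
          Real.log X ^ (3 : ℕ) / Real.log X * (θ - 1) := hwin
    _ = C₀ * Real.exp (4 * (3 : ℕ) + 7 * Bsum c' D * Real.log (4 * X) + (36 + 7 * M0)) *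
          Real.log X ^ 2 * (θ - 1) := by rw [mul_div_assoc, hlog2]
    _ ≤ C₀ * E₀ * Real.log X ^ 2 * (θ - 1) := by gcongr
    _ = C₀ * E₀ * (θ - 1) * Real.log X ^ 2 := by ring

/-- **The whole logarithmic sum of `gC` up to `4𝓛¹⁴`**: for `D ≥ D₀(c′)`,
`Σ_{n ≤ 4𝓛¹⁴} gC c′ D (n)/n ≤ e^{12+1134π+36+7M₀+7(2+S₃)S₄}·(3 + 14 log 𝓛)³` (the Euler-product majorant
with exponent `3`; `log(4𝓛¹⁴) ≤ log 4 + 14 log 𝓛`). [cite: HallTenenbaum1988, (0.4)] -/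
theorem sum_gC_div_le_small (c' : ℝ) : ∃ D₀ : ℕ, ∀ D : ℕ, D₀ ≤ D →
    ∑ n ∈ Icc 1 ⌊4 * ell D ^ 14⌋₊, gC c' D n / n ≤
      Real.exp (4 * (3 : ℕ) + 1134 * π + (36 + 7 * M0) +
        7 * (2 + LogEulerProduct.tailConst 3) * LogEulerProduct.tailConst 4) *
        (3 + 14 * Real.log (ell D)) ^ 3 := by
  have hT3 := LogEulerProduct.tailConst_nonneg 3
  have hT4 := LogEulerProduct.tailConst_nonneg 4
  have hM0 := M0_nonneg
  set E₁ : ℝ := Real.exp (4 * (3 : ℕ) + 1134 * π + (36 + 7 * M0) +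
    7 * (2 + LogEulerProduct.tailConst 3) * LogEulerProduct.tailConst 4) with hE₁
  refine ⟨⌈Real.exp (5 * |c'| * π + 3)⌉₊, fun D hD => ?_⟩
  obtain ⟨hL3, hB⟩ := three_le_ell_and_Bsum_le hD
  set ℓ : ℝ := ell D with hℓ
  have hℓ1 : 1 ≤ ℓ := by linarith
  have hℓ0 : 0 < ℓ := by linarith
  have hB0 : 0 ≤ Bsum c' D := Bsum_nonneg c' D
  have hK : 0 ≤ 7 * Bsum c' D := by positivity
  have hM : (0 : ℝ) ≤ 36 + 7 * M0 := by positivity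
  set X₁ : ℕ := ⌊4 * ℓ ^ 14⌋₊ with hX₁
  have hl14 : (1 : ℝ) ≤ ℓ ^ 14 := one_le_pow₀ hℓ1
  have hX₁2 : 2 ≤ X₁ := by rw [hX₁]; exact Nat.le_floor (by push_cast; linarith)
  have hX₁le : (X₁ : ℝ) ≤ 4 * ℓ ^ 14 := Nat.floor_le (by positivity)
  have hX₁pos : (0 : ℝ) < X₁ := by exact_mod_cast (by omega : 0 < X₁)
  have hmaj := sum_div_le_gen (f := fun n => gC c' D n) (isMultiplicative_gC c' D).map_one
    (fun m n hmn => (isMultiplicative_gC c' D).map_mul_of_coprime hmn) (gC_nonneg c' D)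
    (a := 3) (d := 4) (K := 7 * Bsum c' D) (M := 36 + 7 * M0)
    (C₅ := 7 * (2 + LogEulerProduct.tailConst 3)) hK hM (by positivity) hX₁2
    (fun p hp => summable_gC_local c' D hp)
    (fun p hp _ => gC_prime_le_aKM c' D hp)
    (fun p ν hp _ => gC_prime_pow_le c' D hp ν)
  have hlogℓ0 : 0 ≤ Real.log ℓ := Real.log_nonneg hℓ1
  have hlogℓ : Real.log ℓ ≤ ℓ := (Real.log_le_sub_one_of_pos hℓ0).trans (by linarith)
  have hlog16X₁ : Real.log (4 * X₁) ≤ 3 + 14 * Real.log ℓ + 15 * ℓ := by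
    have h16 : (4 : ℝ) * X₁ ≤ 16 * ℓ ^ 14 := by linarith
    calc Real.log (4 * X₁) ≤ Real.log (16 * ℓ ^ 14) := Real.log_le_log (by positivity) h16
      _ = Real.log 16 + 14 * Real.log ℓ := by
          rw [Real.log_mul (by norm_num) (by positivity), Real.log_pow]; push_cast; ring
      _ ≤ 3 + 14 * Real.log ℓ + 15 * ℓ := by
          have : Real.log 16 ≤ 3 := by
            rw [show (16:ℝ) = 2 ^ 4 by norm_num, Real.log_pow]
            have h3 := Real.log_two_lt_d9
            push_cast; nlinarith
          nlinarith
  have hlogX₁ : Real.log X₁ ≤ 3 + 14 * Real.log ℓ := by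
    calc Real.log X₁ ≤ Real.log (4 * ℓ ^ 14) := Real.log_le_log hX₁pos hX₁le
      _ = Real.log 4 + 14 * Real.log ℓ := by
          rw [Real.log_mul (by norm_num) (by positivity), Real.log_pow]; push_cast; ring
      _ ≤ 3 + 14 * Real.log ℓ := by
          have : Real.log 4 ≤ 3 := by
            rw [show (4:ℝ) = 2 ^ 2 by norm_num, Real.log_pow]
            have h3 := Real.log_le_sub_one_of_pos (show (0:ℝ) < 2 by norm_num)
            push_cast; nlinarith
          linarith
  have hlogX₁0 : 0 ≤ Real.log X₁ := Real.log_nonneg (by exact_mod_cast (by omega : 1 ≤ X₁))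
  have hKlog : 7 * Bsum c' D * Real.log (4 * X₁) ≤ 1134 * π := by
    have hlog0 : 0 ≤ Real.log (4 * X₁) := Real.log_nonneg (by
      have : (2 : ℝ) ≤ X₁ := by exact_mod_cast hX₁2
      linarith)
    have h18 : 3 + 14 * Real.log ℓ + 15 * ℓ ≤ 18 * ℓ ^ 9 := by
      have h8 : (6561 : ℝ) ≤ ℓ ^ 8 := by
        calc (6561 : ℝ) = 3 ^ 8 := by norm_num
          _ ≤ ℓ ^ 8 := pow_le_pow_left₀ (by norm_num) hL3 8
      have h19 : 6561 * ℓ ≤ ℓ ^ 9 := by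
        calc 6561 * ℓ ≤ ℓ ^ 8 * ℓ := mul_le_mul_of_nonneg_right h8 hℓ0.le
          _ = ℓ ^ 9 := by ring
      nlinarith
    calc 7 * Bsum c' D * Real.log (4 * X₁) ≤ 7 * (9 * π / ℓ ^ 9) * (18 * ℓ ^ 9) := by
          refine mul_le_mul (by gcongr) (hlog16X₁.trans h18) hlog0 (by positivity)
      _ = 1134 * π := by field_simp; ring
  have hexp : Real.exp (4 * (3 : ℕ) + 7 * Bsum c' D * Real.log (4 * X₁) + (36 + 7 * M0) +
      7 * (2 + LogEulerProduct.tailConst 3) * LogEulerProduct.tailConst 4) ≤ E₁ := by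
    rw [hE₁]; exact Real.exp_le_exp.mpr (by linarith)
  have hE₁0 : 0 ≤ E₁ := (Real.exp_pos _).le
  calc ∑ n ∈ Icc 1 X₁, gC c' D n / n
      ≤ Real.exp (4 * (3 : ℕ) + 7 * Bsum c' D * Real.log (4 * X₁) + (36 + 7 * M0) +
          7 * (2 + LogEulerProduct.tailConst 3) * LogEulerProduct.tailConst 4) *
          Real.log X₁ ^ (3 : ℕ) := hmaj
    _ ≤ E₁ * (3 + 14 * Real.log ℓ) ^ 3 :=
        mul_le_mul hexp (pow_le_pow_left₀ hlogX₁0 hlogX₁ 3) (pow_nonneg hlogX₁0 3) hE₁0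

/-- **The `n`-window of `gC`, uniform form, general ratio.** There is an absolute `C ≥ 0` such that for
every `c′` and `D ≥ D₀(c′)`: for `1 < θ ≤ 2` with `2𝓛⁻¹⁰ ≤ θ − 1 ≤ 8𝓛⁻¹⁰`, `0 < X ≤ P`, and any finite
set `S` of integers `n ≥ 1` with `X < n < θX`, `Σ_{n∈S} gC c′ D (n)/n ≤ C·𝓛⁸`.
[cite: Zhang2022LandauSiegel, §7 Prop. 7.1 p.33; §12 p.67] -/
theorem window_gC_div_le_gen : ∃ C : ℝ, 0 ≤ C ∧ ∀ c' : ℝ, ∃ D₀ : ℕ, ∀ D : ℕ, D₀ ≤ D →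
    ∀ X θ : ℝ, 1 < θ → θ ≤ 2 → 2 * (ell D ^ 10)⁻¹ ≤ θ - 1 → θ - 1 ≤ 8 * (ell D ^ 10)⁻¹ →
    0 < X → X ≤ bigP D →
    ∀ S : Finset ℕ, (∀ n ∈ S, 1 ≤ n ∧ X < n ∧ (n : ℝ) < θ * X) →
      ∑ n ∈ S, gC c' D n / n ≤ C * ell D ^ 8 := by
  obtain ⟨C₁, hC₁, hSh⟩ := window_gC_div_le_shiu
  have hT3 := LogEulerProduct.tailConst_nonneg 3
  have hT4 := LogEulerProduct.tailConst_nonneg 4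
  have hM0 := M0_nonneg
  set E₁ : ℝ := Real.exp (4 * (3 : ℕ) + 1134 * π + (36 + 7 * M0) +
    7 * (2 + LogEulerProduct.tailConst 3) * LogEulerProduct.tailConst 4) with hE₁
  refine ⟨32 * C₁ + 4913 * E₁, by positivity, fun c' => ?_⟩
  obtain ⟨D₁, hD₁⟩ := hSh c'
  obtain ⟨D₂, hD₂⟩ := sum_gC_div_le_small c'
  refine ⟨max (max D₁ D₂) ⌈Real.exp 3⌉₊, fun D hD X θ hθ1 hθ2 hθlo hθhi hX0 hXP S hS => ?_⟩
  have hDD₁ : D₁ ≤ D := le_trans (le_trans (le_max_left _ _) (le_max_left _ _)) hD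
  have hDD₂ : D₂ ≤ D := le_trans (le_trans (le_max_right _ _) (le_max_left _ _)) hD
  have hL3 : 3 ≤ ell D := Section4.le_ell_of_ceil_exp_le (le_trans (le_max_right _ _) hD)
  set ℓ : ℝ := ell D with hℓ
  have hℓ1 : 1 ≤ ℓ := by linarith
  have hℓ0 : 0 < ℓ := by linarith
  have hl8 : (1 : ℝ) ≤ ℓ ^ 8 := one_le_pow₀ hℓ1
  have hlogP : Real.log (bigP D) = ℓ ^ 9 := by rw [bigP, Real.log_exp]
  have hS0 : ∀ n ∈ S, 0 ≤ gC c' D n / n := fun n _ =>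
    div_nonneg (gC_nonneg c' D n) (Nat.cast_nonneg n)
  have hE₁0 : 0 ≤ E₁ := (Real.exp_pos _).le
  rcases le_or_gt (ℓ ^ 14) X with hX14 | hX14
  · have h := hD₁ D hDD₁ X θ hθ1 hθ2 hθlo hX14 hXP S hS
    have hlogX0 : 0 ≤ Real.log X := Real.log_nonneg (by
      have : (1:ℝ) ≤ ℓ ^ 14 := one_le_pow₀ hℓ1; linarith)
    have hlogXP : Real.log X ≤ ℓ ^ 9 := by rw [← hlogP]; exact Real.log_le_log hX0 hXP
    have hlogsq : Real.log X ^ 2 ≤ ℓ ^ 18 := by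
      calc Real.log X ^ 2 ≤ (ℓ ^ 9) ^ 2 := pow_le_pow_left₀ hlogX0 hlogXP 2
        _ = ℓ ^ 18 := by ring
    calc ∑ n ∈ S, gC c' D n / n ≤ C₁ * (θ - 1) * Real.log X ^ 2 := h
      _ ≤ C₁ * (8 * (ell D ^ 10)⁻¹) * ℓ ^ 18 := by gcongr
      _ = 8 * C₁ * ℓ ^ 8 := by rw [hℓ]; field_simp
      _ ≤ (32 * C₁ + 4913 * E₁) * ℓ ^ 8 := by nlinarith [mul_nonneg hC₁ (by positivity : (0:ℝ) ≤ ℓ ^ 8)]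
  · -- small `X`: the whole sum up to `4𝓛¹⁴`
    have hsub : S ⊆ Icc 1 ⌊4 * ell D ^ 14⌋₊ := by
      intro n hn
      obtain ⟨h1, -, h3⟩ := hS n hn
      rw [mem_Icc]
      refine ⟨h1, Nat.le_floor ?_⟩
      have : θ * X ≤ 2 * X := mul_le_mul_of_nonneg_right hθ2 hX0.le
      rw [← hℓ]; linarith
    have hlogℓ : Real.log ℓ ≤ ℓ := (Real.log_le_sub_one_of_pos hℓ0).trans (by linarith)
    have hlogℓ0 : 0 ≤ Real.log ℓ := Real.log_nonneg hℓ1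
    have h17 : (3 + 14 * Real.log ℓ) ^ 3 ≤ 4913 * ℓ ^ 8 := by
      calc (3 + 14 * Real.log ℓ) ^ 3 ≤ (17 * ℓ) ^ 3 :=
            pow_le_pow_left₀ (by positivity) (by nlinarith) 3
        _ = 4913 * ℓ ^ 3 := by ring
        _ ≤ 4913 * ℓ ^ 8 := by
            have : ℓ ^ 3 ≤ ℓ ^ 8 := pow_le_pow_right₀ hℓ1 (by norm_num)
            linarith
    calc ∑ n ∈ S, gC c' D n / n ≤ ∑ n ∈ Icc 1 ⌊4 * ell D ^ 14⌋₊, gC c' D n / n :=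
          sum_le_sum_of_subset_of_nonneg hsub fun n _ _ =>
            div_nonneg (gC_nonneg c' D n) (Nat.cast_nonneg n)
      _ ≤ E₁ * (3 + 14 * Real.log ℓ) ^ 3 := hD₂ D hDD₂
      _ ≤ E₁ * (4913 * ℓ ^ 8) := mul_le_mul_of_nonneg_left h17 hE₁0
      _ ≤ (32 * C₁ + 4913 * E₁) * ℓ ^ 8 := by nlinarith [mul_nonneg hC₁ (by positivity : (0:ℝ) ≤ ℓ ^ 8)]

end Literature.NumberTheory.LFunctions.Zhang2022.ThinWindow
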